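/-
Copyright (c) 2026 the pub-hodgecm-mathlib formalisation cell (harness21).  Prover seat hodgecm-mathlib-R90-CS-p03 (g0), R90-TF section S8 «ContSpec-n½» (dealer R90-CS-plan (g2),
deal S8-R65 (2)(a), census `R90/S8/CENSUS-ChiEulerProductU3.R90-CS-p03-g0.md`, file (a-1)): the FINITE-ADELIC EULER PRODUCT of the `χ`-weighted intertwining integrand of
`U(2,1)_{L∕L⁺}` — the `χ`-twin of ★ `K2E1IntertwiningScalarEulerProductU3Finite` (3-iii-b2), HYPOTHESIS-FIRST on the local weights and the local tokens.
-/
import Summits.HodgeConjecture.HodgeConjecture.Theorems.K2E1IntertwiningScalarEulerProductU3Finite   -- ★ (3-iii-b2, K2E2-p12): `eq_prod_mul_of_hasProd` (HasProd × Euler product off `S₀`); brings ★ `AdelicProductIntegral`, ★ `K2E1IntertwiningLocalMeanCMU3` (`localHeight_eq_one_of_mem_integralBox`)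
import Summits.HodgeConjecture.HodgeConjecture.Theorems.K2E1CMPlaceLettersU3                        -- ★ (this seat): the packaged tokens `prod_placesOver_eShape_mul_fShape_eq_inertToken ∕ _eq_splitToken`; brings ★ B2 `hasProd_localMeans_eq_chiScalar`
import HarnessLib

/-!
# K2·E1 ∕ R90·S8 — `K2E1ChiIntertwiningScalarEulerProductU3Finite` (file (a-1)): THE FINITE-ADELIC EULER PRODUCT OF THE `χ`-WEIGHTED INTERTWINING INTEGRAND OF `U(2,1)_{L∕L⁺}` —
# `μ(𝒪̂³)⁻¹·∫_{(𝔸_{L⁺,f})³} ∏ᶠ_v ω_v(x_v)·Q_v(x_v)^{−z} dμ = (∏_{v ∈ S₀} m_v(z)) · c_χ^{S}(z)` on `{2 < Re z}`, `c_χ^S = [L_L^S(z−1,φ)·L_{L⁺}^{S₀}(2z−2,η)] ∕ [L_L^S(z,φ)·L_{L⁺}^{S₀}(2z−1,η)]`,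
# `η = φ′·ω_{L∕L⁺}` — Tate 3.3.1 glued to ★ B2 + ★ (b), hypothesis-first on the local weights `ω_v` and the good-place tokens

Cell `pub/hodgecm-mathlib`, crux h413 = `stmt-HodgeConjecture-24833`, route of record `HCCMUnconditional`; R90-TF section S8 «ContSpec-n½» (file B ED. 4: #3 :409, #2♯ :433), road R2-χ₃.
THEOREMS ONLY (no `def`, no `instance`, no notation, no named-fact hypothesis, no `sorry`; default heartbeats); lane `--supports stmt-HodgeConjecture-24833 --as helper` (count-neutral).
Closes no socket.

THE MATHEMATICS ([TateThesis1967, Thm 3.3.1]; [Langlands1971, §3]; [Rogawski1990, §13.9 p. 229]).  On the big cell, the `χ`-section's intertwining integrand at a finite place `v` of `L⁺` is the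
spherical height factor `Q_v^{−z}` (★ `K2E1IntertwiningLocalHeightU3`, the `∏_{w∣v} max 1 (max ‖·‖ ‖·‖)` below — bytes of ★ 3-iii-b2 VERBATIM) times a LOCAL WEIGHT `ω_v : (L⁺_v)³ → ℂ` (the
Iwasawa `χ`-weight; its shell structure is R90-C10-p07's (W) `K2E1ChiLocalWeightShellU3`).  THIS FILE takes the weight family `ω` as DATA with three letters — `hωc` (each `ω_v·Q_v^{−z}` is
continuous), `hω1` (`ω_v = 1` on `𝒪_v³` off the bad finset `S₀`), `hint` (the global product is integrable, as in the model) — and the good-place TOKEN letters in EXACTLY the conclusion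
shape of ★ B1-local `chiLocalMean_eq_token_of_shell_nonsplit` (inert, `hin`) and of the split sequel (`hsp`), and proves:
* §1 **`hasProd_chiLocalMean_three`** — Tate's Thm 3.3.1 (★ `AdelicProductIntegral.hasProd_localIntegral_of_integrable`) at `f_v := ω_v·Q_v^{−z}`: the normalised local `χ`-means
  `m_v(z) = ν_v(𝒪_v³)⁻¹·∫ ω_v Q_v^{−z}` are multipliable with product `μ(𝒪̂³)⁻¹·∫ ∏ᶠ_v ω_v Q_v^{−z}` (every `z`; `hf1` from `hω1` + ★ `localHeight_eq_one_of_mem_integralBox`).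
* §2 **`hasProd_chiLocalMean_eq_chiScalar_off`** — off `S₀` the local means `HasProd`-converge to ★ F4's `c_χ^S(z)` (`S := {w ∣ w ∩ 𝓞L⁺ ∈ S₀}`): ★ B2 `hasProd_localMeans_eq_chiScalar` with
  `hm` fed, place by place, by ★ (b)'s packaged tokens (`c • w = w`: inert; else split) and the token letters `hin ∕ hsp`.
* §3 HEAD **`inv_measure_smul_integral_finprod_chi_eq_prod_mul_chiScalar_three`** — `μ(𝒪̂³)⁻¹·∫ ∏ᶠ_v ω_v Q_v^{−z} = (∏_{v∈S₀} m_v(z)) · c_χ^S(z)` (★ `eq_prod_mul_of_hasProd`).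
What pays the letters: `hin` = ★ B1-local ∘ (W) inert shell letter; `hsp` = split sequel (K2E1-p13) ∘ (W) split shell letter; `hωc ∕ hω1` = (W) (shell-constant weights); `hint` = Godement ∘ ★ (ν-1)
as in ★ 3-iv-c; `hres` (φ′ as a Hecke character of `L⁺`) = the global assembly (a-2) `K2E1ChiIntertwiningScalarEulerProductU3` (unfolding + archimedean factor + definition of `ω` from the section).
HONEST LABEL: HC_CM is proved only modulo the 7 printed citations (2 remaining named inputs: hLiu418 = `stmt-HodgeConjecture-24832`, h413 = `stmt-HodgeConjecture-24833`) until rung 0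
closes; REL ≠ ★ ≠ BUILT; count-neutral helper; closes no socket; conditional only on its displayed letters.

## References
* [TateThesis1967] J. Tate, *Fourier analysis in number fields and Hecke's zeta-functions* (1967): Thm 3.3.1, Lemma 3.3.2.
* [Langlands1971] R. P. Langlands, *Euler Products* (1971): §3.
* [Rogawski1990] J. D. Rogawski, *Automorphic Representations of Unitary Groups in Three Variables* (1990): §4.5, §13.9 p. 229.
* [MoeglinWaldspurger1995] C. Mœglin, J.-L. Waldspurger, *Spectral Decomposition and Eisenstein Series* (1995): II.1.7, IV.1.11.
-/

set_option autoImplicit false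
set_option linter.dupNamespace false -- the mandated namespace repeats `HodgeConjecture.HodgeConjecture`

noncomputable section

open MeasureTheory NumberField IsDedekindDomain Filter Topology
open scoped NNReal ENNReal
open Literature.NumberTheory.Automorphic Literature.NumberTheory.Automorphic.UnitaryGroup Literature.NumberTheory.GaloisRepresentations
open Literature.NumberTheory.GaloisRepresentations.IsNonarchimedeanLocalField Literature.NumberTheory.LFunctions
open Summit.HodgeConjecture.HodgeConjecture.Cruxes.H413.AdelicProductIntegral (hasProd_localIntegral_of_integrable)
open Summit.HodgeConjecture.HodgeConjecture.Cruxes.H413.K2E1IntertwiningLocalMeanCMU3 (localHeight_eq_one_of_mem_integralBox)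
open Summit.HodgeConjecture.HodgeConjecture.Cruxes.H413.K2E1IntertwiningScalarEulerProductU3Finite (eq_prod_mul_of_hasProd)
open Summit.HodgeConjecture.HodgeConjecture.Cruxes.H413.K2E1ChiIntertwiningScalarEulerJunctionU3 (hasProd_localMeans_eq_chiScalar)
open Summit.HodgeConjecture.HodgeConjecture.Cruxes.H413.K2E1CMPlaceLettersU3 (prod_placesOver_eShape_mul_fShape_eq_inertToken prod_placesOver_eShape_mul_fShape_eq_splitToken)

namespace Summit.HodgeConjecture.HodgeConjecture.Cruxes.H413.K2E1ChiIntertwiningScalarEulerProductU3Finite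

variable (L : Type) [Field L] [NumberField L] [IsCMField L] {δ : L} (hcδ : IsCMField.complexConj L δ = -δ) (hδ : δ ≠ 0)
  {d : ↥(maximalRealSubfield L)} (hd : δ * δ = algebraMap ↥(maximalRealSubfield L) L d)
  [MeasurableSpace (FiniteAdeleRing (𝓞 ↥(maximalRealSubfield L)) ↥(maximalRealSubfield L))] [BorelSpace (FiniteAdeleRing (𝓞 ↥(maximalRealSubfield L)) ↥(maximalRealSubfield L))]
  [∀ v : HeightOneSpectrum (𝓞 ↥(maximalRealSubfield L)), MeasurableSpace (v.adicCompletion ↥(maximalRealSubfield L))]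
  [∀ v : HeightOneSpectrum (𝓞 ↥(maximalRealSubfield L)), BorelSpace (v.adicCompletion ↥(maximalRealSubfield L))]
  (μ : Measure (Fin 3 → FiniteAdeleRing (𝓞 ↥(maximalRealSubfield L)) ↥(maximalRealSubfield L))) [μ.IsAddHaarMeasure]
  (νv : ∀ v : HeightOneSpectrum (𝓞 ↥(maximalRealSubfield L)), Measure (v.adicCompletion ↥(maximalRealSubfield L))) [∀ v, (νv v).IsAddHaarMeasure]
  (S₀ : Finset (HeightOneSpectrum (𝓞 ↥(maximalRealSubfield L))))
  (ω : ∀ v : HeightOneSpectrum (𝓞 ↥(maximalRealSubfield L)), (Fin 3 → v.adicCompletion ↥(maximalRealSubfield L)) → ℂ) (z : ℂ)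

/-! ## §1 Tate 3.3.1 for the `χ`-weighted integrand: the local `χ`-means are multipliable with product the normalised global integral -/

include hd in
/-- **THE LOCAL `χ`-MEANS `m_v(z) = ν_v(𝒪_v³)⁻¹·∫ ω_v·Q_v^{−z}` ARE MULTIPLIABLE WITH PRODUCT `μ(𝒪̂³)⁻¹·∫ ∏ᶠ_v ω_v(x_v)·Q_v(x_v)^{−z} dμ`** (★ `AdelicProductIntegral.hasProd_localIntegral_of_integrable` at
`K = L⁺`, `ι = Fin 3`, `ν_v = ν⊗ν⊗ν`, `f_v = ω_v·((Q_v : ℝ) : ℂ)^{−z}`; `hf1` from `hω1` and ★ `localHeight_eq_one_of_mem_integralBox`; letters `hgood`, `hωc`, `hω1`, `hint`).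
[cite: TateThesis1967, Thm 3.3.1] [cite: Langlands1971, §3] -/
theorem hasProd_chiLocalMean_three
    (hgood : ∀ v ∉ S₀, Algebra.IsUnramifiedIn (𝓞 L) v.asIdeal ∧ Valued.v (2 : v.adicCompletion ↥(maximalRealSubfield L)) = 1 ∧
      ∀ w : PlacesOver L v, Valued.v (algebraMap L (LocalRing L v) δ w) = 1)
    (hωc : ∀ v, Continuous fun p : Fin 3 → v.adicCompletion ↥(maximalRealSubfield L) =>
      ω v p * (((∏ w' : PlacesOver L v, max 1 (max ((normAbs (w'.1.adicCompletion L) (quadraticLocalEquiv L v (IsCMField.complexConj L) hcδ hδ (p 0, p 1) w') : ℝ≥0) : ℝ)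
          ((normAbs (w'.1.adicCompletion L) ((toLocalRing L v (p 2) * algebraMap L (LocalRing L v) δ -
            toLocalRing L v 2⁻¹ * (quadraticLocalEquiv L v (IsCMField.complexConj L) hcδ hδ (p 0, p 1) *
              conjLocal L (IsCMField.complexConj L) v (quadraticLocalEquiv L v (IsCMField.complexConj L) hcδ hδ (p 0, p 1)))) w') : ℝ≥0) : ℝ))) : ℝ) : ℂ) ^ (-z))
    (hω1 : ∀ v ∉ S₀, ∀ p ∈ integralBox ↥(maximalRealSubfield L) (Fin 3) v, ω v p = 1)
    (hint : Integrable (fun x : Fin 3 → FiniteAdeleRing (𝓞 ↥(maximalRealSubfield L)) ↥(maximalRealSubfield L) =>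
      ∏ᶠ v : HeightOneSpectrum (𝓞 ↥(maximalRealSubfield L)),
        ω v (fun i => x i v) * (((∏ w' : PlacesOver L v, max 1 (max ((normAbs (w'.1.adicCompletion L) (quadraticLocalEquiv L v (IsCMField.complexConj L) hcδ hδ (x 0 v, x 1 v) w') : ℝ≥0) : ℝ)
          ((normAbs (w'.1.adicCompletion L) ((toLocalRing L v (x 2 v) * algebraMap L (LocalRing L v) δ -
            toLocalRing L v 2⁻¹ * (quadraticLocalEquiv L v (IsCMField.complexConj L) hcδ hδ (x 0 v, x 1 v) *
              conjLocal L (IsCMField.complexConj L) v (quadraticLocalEquiv L v (IsCMField.complexConj L) hcδ hδ (x 0 v, x 1 v)))) w') : ℝ≥0) : ℝ))) : ℝ) : ℂ) ^ (-z)) μ) :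
    HasProd (fun v : HeightOneSpectrum (𝓞 ↥(maximalRealSubfield L)) =>
        ((Measure.pi fun _ : Fin 3 => νv v) (integralBox ↥(maximalRealSubfield L) (Fin 3) v)).toReal⁻¹ •
          ∫ p : Fin 3 → v.adicCompletion ↥(maximalRealSubfield L),
            ω v p * (((∏ w' : PlacesOver L v, max 1 (max ((normAbs (w'.1.adicCompletion L) (quadraticLocalEquiv L v (IsCMField.complexConj L) hcδ hδ (p 0, p 1) w') : ℝ≥0) : ℝ)
              ((normAbs (w'.1.adicCompletion L) ((toLocalRing L v (p 2) * algebraMap L (LocalRing L v) δ -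
                toLocalRing L v 2⁻¹ * (quadraticLocalEquiv L v (IsCMField.complexConj L) hcδ hδ (p 0, p 1) *
                  conjLocal L (IsCMField.complexConj L) v (quadraticLocalEquiv L v (IsCMField.complexConj L) hcδ hδ (p 0, p 1)))) w') : ℝ≥0) : ℝ))) : ℝ) : ℂ) ^ (-z)
            ∂(Measure.pi fun _ : Fin 3 => νv v))
      ((μ (offBox (K := ↥(maximalRealSubfield L)) (ι := Fin 3) ∅)).toReal⁻¹ •
        ∫ x : Fin 3 → FiniteAdeleRing (𝓞 ↥(maximalRealSubfield L)) ↥(maximalRealSubfield L),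
          ∏ᶠ v : HeightOneSpectrum (𝓞 ↥(maximalRealSubfield L)),
            ω v (fun i => x i v) * (((∏ w' : PlacesOver L v, max 1 (max ((normAbs (w'.1.adicCompletion L) (quadraticLocalEquiv L v (IsCMField.complexConj L) hcδ hδ (x 0 v, x 1 v) w') : ℝ≥0) : ℝ)
              ((normAbs (w'.1.adicCompletion L) ((toLocalRing L v (x 2 v) * algebraMap L (LocalRing L v) δ -
                toLocalRing L v 2⁻¹ * (quadraticLocalEquiv L v (IsCMField.complexConj L) hcδ hδ (x 0 v, x 1 v) *
                  conjLocal L (IsCMField.complexConj L) v (quadraticLocalEquiv L v (IsCMField.complexConj L) hcδ hδ (x 0 v, x 1 v)))) w') : ℝ≥0) : ℝ))) : ℝ) : ℂ) ^ (-z) ∂μ) := by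
  haveI : ∀ v : HeightOneSpectrum (𝓞 ↥(maximalRealSubfield L)), SecondCountableTopology (v.adicCompletion ↥(maximalRealSubfield L)) :=
    fun v => secondCountableTopology_localField _
  haveI : ∀ v : HeightOneSpectrum (𝓞 ↥(maximalRealSubfield L)), SigmaCompactSpace (v.adicCompletion ↥(maximalRealSubfield L)) :=
    fun v => sigmaCompactSpace_of_isNonarchimedeanLocalField _
  refine hasProd_localIntegral_of_integrable ↥(maximalRealSubfield L) (Fin 3) μ (fun v => Measure.pi fun _ : Fin 3 => νv v)
    (fun v p => ω v p * (((∏ w' : PlacesOver L v, max 1 (max ((normAbs (w'.1.adicCompletion L) (quadraticLocalEquiv L v (IsCMField.complexConj L) hcδ hδ (p 0, p 1) w') : ℝ≥0) : ℝ)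
      ((normAbs (w'.1.adicCompletion L) ((toLocalRing L v (p 2) * algebraMap L (LocalRing L v) δ -
        toLocalRing L v 2⁻¹ * (quadraticLocalEquiv L v (IsCMField.complexConj L) hcδ hδ (p 0, p 1) *
          conjLocal L (IsCMField.complexConj L) v (quadraticLocalEquiv L v (IsCMField.complexConj L) hcδ hδ (p 0, p 1)))) w') : ℝ≥0) : ℝ))) : ℝ) : ℂ) ^ (-z))
    S₀ hωc (fun v hv p hp => ?_) hint
  -- `hf1`: off `S₀`, on `𝒪_v³` the weight is `1` and the height factor is `1`
  show ω v p * _ = 1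
  rw [hω1 v hv p hp, localHeight_eq_one_of_mem_integralBox L hcδ hδ hd v (hgood v hv).1 (hgood v hv).2.1 (hgood v hv).2.2 hp, Complex.ofReal_one, Complex.one_cpow, one_mul]

/-! ## §2 Off `S₀`: the local `χ`-means `HasProd`-converge to ★ F4's `c_χ^S(z)` (★ B2 + ★ (b), token letters `hin ∕ hsp`) -/

omit [MeasurableSpace (FiniteAdeleRing (𝓞 ↥(maximalRealSubfield L)) ↥(maximalRealSubfield L))] [BorelSpace (FiniteAdeleRing (𝓞 ↥(maximalRealSubfield L)) ↥(maximalRealSubfield L))]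
  [∀ v : HeightOneSpectrum (𝓞 ↥(maximalRealSubfield L)), MeasurableSpace (v.adicCompletion ↥(maximalRealSubfield L))]
  [∀ v : HeightOneSpectrum (𝓞 ↥(maximalRealSubfield L)), BorelSpace (v.adicCompletion ↥(maximalRealSubfield L))] in
/-- **OFF `S₀`, `∏' m_v(z) = c_χ^S(z)`** (`S := {w ∣ w ∩ 𝓞L⁺ ∈ S₀}`, `2 < Re z`): the local `χ`-means — ANY family `m` — matching, at each good place, ★ B1-local's inert token
(`hin`, at a `c`-fixed `w ∣ v`) resp. the split token (`hsp`, at a `c`-moved one) `HasProd`-converge to `[P_L(z−1;φ)·P_{L⁺}(2z−2;η)] ∕ [P_L(z;φ)·P_{L⁺}(2z−1;η)]`, `η := ψ·ω_{L∕L⁺}`,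
`ψ = φ|_{𝕀_{L⁺}}` (`hres`) — ★ B2 `hasProd_localMeans_eq_chiScalar` with `hm` from ★ (b) `prod_placesOver_eShape_mul_fShape_eq_inertToken ∕ _eq_splitToken`.
[cite: Rogawski1990, §13.9 p. 229] [cite: Langlands1971, §3] -/
theorem hasProd_chiLocalMean_eq_chiScalar_off {φ : HeckeCharacter L} {ψ : HeckeCharacter ↥(maximalRealSubfield L)} (hφ : φ.IsUnitary) (hψ : (ψ * quadraticHeckeCharCM L).IsUnitary)
    (hres : ∀ x, φ (AdeleRing.ideleBaseChange ↥(maximalRealSubfield L) L x) = ψ x) (hz : 2 < z.re)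
    (hgood : ∀ v ∉ S₀, Algebra.IsUnramifiedIn (𝓞 L) v.asIdeal ∧ ∀ w : PlacesOver L v, φ.IsUnramifiedAt w.1)
    (m : HeightOneSpectrum (𝓞 ↥(maximalRealSubfield L)) → ℂ)
    (hin : ∀ v ∉ S₀, ∀ w : PlacesOver L v, IsCMField.complexConj L • w.1 = w.1 →
      m v = (1 - φ.valueAtUniformizer w.1 * (v.residueCard : ℂ) ^ (-(2 * z))) * (1 + φ.valueAtUniformizer w.1 * (v.residueCard : ℂ) ^ (-(2 * z - 1))) /
        ((1 - φ.valueAtUniformizer w.1 * (v.residueCard : ℂ) ^ (-(2 * z - 2))) * (1 + φ.valueAtUniformizer w.1 * (v.residueCard : ℂ) ^ (-(2 * z - 2)))))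
    (hsp : ∀ v ∉ S₀, ∀ w : PlacesOver L v, IsCMField.complexConj L • w.1 ≠ w.1 →
      m v = (1 - φ.valueAtUniformizer w.1 * (v.residueCard : ℂ) ^ (-z)) * (1 - φ.valueAtUniformizer (PlacesOver.galInv (IsCMField.complexConj L) w).1 * (v.residueCard : ℂ) ^ (-z)) *
          (1 - φ.valueAtUniformizer w.1 * φ.valueAtUniformizer (PlacesOver.galInv (IsCMField.complexConj L) w).1 * (v.residueCard : ℂ) ^ (-(2 * z - 1))) /
        ((1 - φ.valueAtUniformizer w.1 * (v.residueCard : ℂ) ^ (-(z - 1))) * (1 - φ.valueAtUniformizer (PlacesOver.galInv (IsCMField.complexConj L) w).1 * (v.residueCard : ℂ) ^ (-(z - 1))) *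
          (1 - φ.valueAtUniformizer w.1 * φ.valueAtUniformizer (PlacesOver.galInv (IsCMField.complexConj L) w).1 * (v.residueCard : ℂ) ^ (-(2 * z - 2))))) :
    HasProd (fun v : {v : HeightOneSpectrum (𝓞 ↥(maximalRealSubfield L)) // v ∉ (↑S₀ : Set (HeightOneSpectrum (𝓞 ↥(maximalRealSubfield L))))} => m v.1)
      ((partialStandardL {w : HeightOneSpectrum (𝓞 L) | w.under (𝓞 ↥(maximalRealSubfield L)) ∈ (↑S₀ : Set (HeightOneSpectrum (𝓞 ↥(maximalRealSubfield L))))} (fun w => {φ.valueAtUniformizer w}) (z - 1) *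
          partialStandardL (↑S₀ : Set (HeightOneSpectrum (𝓞 ↥(maximalRealSubfield L)))) (fun v => {(ψ * quadraticHeckeCharCM L).valueAtUniformizer v}) (2 * z - 2)) /
        (partialStandardL {w : HeightOneSpectrum (𝓞 L) | w.under (𝓞 ↥(maximalRealSubfield L)) ∈ (↑S₀ : Set (HeightOneSpectrum (𝓞 ↥(maximalRealSubfield L))))} (fun w => {φ.valueAtUniformizer w}) z *
          partialStandardL (↑S₀ : Set (HeightOneSpectrum (𝓞 ↥(maximalRealSubfield L)))) (fun v => {(ψ * quadraticHeckeCharCM L).valueAtUniformizer v}) (2 * z - 1))) := by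
  haveI : Algebra.IsQuadraticExtension ↥(maximalRealSubfield L) L := IsCMField.isQuadraticExtension L
  refine hasProd_localMeans_eq_chiScalar (E := L) (F := ↥(maximalRealSubfield L)) (T := (↑S₀ : Set (HeightOneSpectrum (𝓞 ↥(maximalRealSubfield L))))) hφ hψ hz m fun v hv => ?_
  have hv' : v ∉ S₀ := fun h => hv (Finset.mem_coe.mpr h)
  obtain ⟨w⟩ := PlacesOver.nonempty L v
  by_cases hw : IsCMField.complexConj L • w.1 = w.1
  · rw [hin v hv' w hw, prod_placesOver_eShape_mul_fShape_eq_inertToken L (hgood v hv').1 w hw hres ((hgood v hv').2 w) z]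
  · rw [hsp v hv' w hw, prod_placesOver_eShape_mul_fShape_eq_splitToken L (hgood v hv').1 w hw hres ((hgood v hv').2 w)
      ((hgood v hv').2 (PlacesOver.galInv (IsCMField.complexConj L) w)) z]

/-! ## §3 HEAD: the normalised global integral is `(∏_{v∈S₀} m_v(z)) · c_χ^S(z)` -/

include hd in
/-- **THE FINITE-ADELIC EULER PRODUCT OF THE `χ`-WEIGHTED `U(2,1)` INTERTWINING INTEGRAND** (`2 < Re z`; `S₀ ⊇` bad places; `η := ψ·ω_{L∕L⁺}`, `ψ = φ|_{𝕀_{L⁺}}`):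
`μ(𝒪̂³)⁻¹·∫_{(𝔸_{L⁺,f})³} ∏ᶠ_v ω_v(x_v)·Q_v(x_v)^{−z} dμ = (∏_{v ∈ S₀} ν_v(𝒪_v³)⁻¹ ∫ ω_v Q_v^{−z}) · [P_L^S(z−1;φ)·P_{L⁺}^{S₀}(2z−2;η)] ∕ [P_L^S(z;φ)·P_{L⁺}^{S₀}(2z−1;η)]` with `S := {w ∣ w ∩ 𝓞L⁺ ∈ S₀}`
— §1 (Tate 3.3.1) with §2 (★ B2 + ★ (b)) through ★ `eq_prod_mul_of_hasProd`.  With ★ F4 `exists_differentiableOn_mul_chiScalar_three` the right-hand Euler quotient continues to `{1 < Re z}`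
with its two pole tests; the letters `hωc hω1 hint hin hsp` are the (W)-side and Godement inputs named in the module docstring.
[cite: TateThesis1967, Thm 3.3.1] [cite: Langlands1971, §3] [cite: Rogawski1990, §13.9 p. 229] [cite: MoeglinWaldspurger1995, IV.1.11] -/
theorem inv_measure_smul_integral_finprod_chi_eq_prod_mul_chiScalar_three {φ : HeckeCharacter L} {ψ : HeckeCharacter ↥(maximalRealSubfield L)} (hφ : φ.IsUnitary)
    (hψ : (ψ * quadraticHeckeCharCM L).IsUnitary) (hres : ∀ x, φ (AdeleRing.ideleBaseChange ↥(maximalRealSubfield L) L x) = ψ x) (hz : 2 < z.re)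
    (hgood : ∀ v ∉ S₀, (Algebra.IsUnramifiedIn (𝓞 L) v.asIdeal ∧ Valued.v (2 : v.adicCompletion ↥(maximalRealSubfield L)) = 1 ∧
      ∀ w : PlacesOver L v, Valued.v (algebraMap L (LocalRing L v) δ w) = 1) ∧ ∀ w : PlacesOver L v, φ.IsUnramifiedAt w.1)
    (hωc : ∀ v, Continuous fun p : Fin 3 → v.adicCompletion ↥(maximalRealSubfield L) =>
      ω v p * (((∏ w' : PlacesOver L v, max 1 (max ((normAbs (w'.1.adicCompletion L) (quadraticLocalEquiv L v (IsCMField.complexConj L) hcδ hδ (p 0, p 1) w') : ℝ≥0) : ℝ)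
          ((normAbs (w'.1.adicCompletion L) ((toLocalRing L v (p 2) * algebraMap L (LocalRing L v) δ -
            toLocalRing L v 2⁻¹ * (quadraticLocalEquiv L v (IsCMField.complexConj L) hcδ hδ (p 0, p 1) *
              conjLocal L (IsCMField.complexConj L) v (quadraticLocalEquiv L v (IsCMField.complexConj L) hcδ hδ (p 0, p 1)))) w') : ℝ≥0) : ℝ))) : ℝ) : ℂ) ^ (-z))
    (hω1 : ∀ v ∉ S₀, ∀ p ∈ integralBox ↥(maximalRealSubfield L) (Fin 3) v, ω v p = 1)
    (hint : Integrable (fun x : Fin 3 → FiniteAdeleRing (𝓞 ↥(maximalRealSubfield L)) ↥(maximalRealSubfield L) =>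
      ∏ᶠ v : HeightOneSpectrum (𝓞 ↥(maximalRealSubfield L)),
        ω v (fun i => x i v) * (((∏ w' : PlacesOver L v, max 1 (max ((normAbs (w'.1.adicCompletion L) (quadraticLocalEquiv L v (IsCMField.complexConj L) hcδ hδ (x 0 v, x 1 v) w') : ℝ≥0) : ℝ)
          ((normAbs (w'.1.adicCompletion L) ((toLocalRing L v (x 2 v) * algebraMap L (LocalRing L v) δ -
            toLocalRing L v 2⁻¹ * (quadraticLocalEquiv L v (IsCMField.complexConj L) hcδ hδ (x 0 v, x 1 v) *
              conjLocal L (IsCMField.complexConj L) v (quadraticLocalEquiv L v (IsCMField.complexConj L) hcδ hδ (x 0 v, x 1 v)))) w') : ℝ≥0) : ℝ))) : ℝ) : ℂ) ^ (-z)) μ)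
    (hin : ∀ v ∉ S₀, ∀ w : PlacesOver L v, IsCMField.complexConj L • w.1 = w.1 →
      ((Measure.pi fun _ : Fin 3 => νv v) (integralBox ↥(maximalRealSubfield L) (Fin 3) v)).toReal⁻¹ •
          ∫ p : Fin 3 → v.adicCompletion ↥(maximalRealSubfield L),
            ω v p * (((∏ w' : PlacesOver L v, max 1 (max ((normAbs (w'.1.adicCompletion L) (quadraticLocalEquiv L v (IsCMField.complexConj L) hcδ hδ (p 0, p 1) w') : ℝ≥0) : ℝ)
              ((normAbs (w'.1.adicCompletion L) ((toLocalRing L v (p 2) * algebraMap L (LocalRing L v) δ -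
                toLocalRing L v 2⁻¹ * (quadraticLocalEquiv L v (IsCMField.complexConj L) hcδ hδ (p 0, p 1) *
                  conjLocal L (IsCMField.complexConj L) v (quadraticLocalEquiv L v (IsCMField.complexConj L) hcδ hδ (p 0, p 1)))) w') : ℝ≥0) : ℝ))) : ℝ) : ℂ) ^ (-z)
            ∂(Measure.pi fun _ : Fin 3 => νv v) =
        (1 - φ.valueAtUniformizer w.1 * (v.residueCard : ℂ) ^ (-(2 * z))) * (1 + φ.valueAtUniformizer w.1 * (v.residueCard : ℂ) ^ (-(2 * z - 1))) /
          ((1 - φ.valueAtUniformizer w.1 * (v.residueCard : ℂ) ^ (-(2 * z - 2))) * (1 + φ.valueAtUniformizer w.1 * (v.residueCard : ℂ) ^ (-(2 * z - 2)))))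
    (hsp : ∀ v ∉ S₀, ∀ w : PlacesOver L v, IsCMField.complexConj L • w.1 ≠ w.1 →
      ((Measure.pi fun _ : Fin 3 => νv v) (integralBox ↥(maximalRealSubfield L) (Fin 3) v)).toReal⁻¹ •
          ∫ p : Fin 3 → v.adicCompletion ↥(maximalRealSubfield L),
            ω v p * (((∏ w' : PlacesOver L v, max 1 (max ((normAbs (w'.1.adicCompletion L) (quadraticLocalEquiv L v (IsCMField.complexConj L) hcδ hδ (p 0, p 1) w') : ℝ≥0) : ℝ)
              ((normAbs (w'.1.adicCompletion L) ((toLocalRing L v (p 2) * algebraMap L (LocalRing L v) δ -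
                toLocalRing L v 2⁻¹ * (quadraticLocalEquiv L v (IsCMField.complexConj L) hcδ hδ (p 0, p 1) *
                  conjLocal L (IsCMField.complexConj L) v (quadraticLocalEquiv L v (IsCMField.complexConj L) hcδ hδ (p 0, p 1)))) w') : ℝ≥0) : ℝ))) : ℝ) : ℂ) ^ (-z)
            ∂(Measure.pi fun _ : Fin 3 => νv v) =
        (1 - φ.valueAtUniformizer w.1 * (v.residueCard : ℂ) ^ (-z)) * (1 - φ.valueAtUniformizer (PlacesOver.galInv (IsCMField.complexConj L) w).1 * (v.residueCard : ℂ) ^ (-z)) *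
            (1 - φ.valueAtUniformizer w.1 * φ.valueAtUniformizer (PlacesOver.galInv (IsCMField.complexConj L) w).1 * (v.residueCard : ℂ) ^ (-(2 * z - 1))) /
          ((1 - φ.valueAtUniformizer w.1 * (v.residueCard : ℂ) ^ (-(z - 1))) * (1 - φ.valueAtUniformizer (PlacesOver.galInv (IsCMField.complexConj L) w).1 * (v.residueCard : ℂ) ^ (-(z - 1))) *
            (1 - φ.valueAtUniformizer w.1 * φ.valueAtUniformizer (PlacesOver.galInv (IsCMField.complexConj L) w).1 * (v.residueCard : ℂ) ^ (-(2 * z - 2))))) :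
    (μ (offBox (K := ↥(maximalRealSubfield L)) (ι := Fin 3) ∅)).toReal⁻¹ •
        ∫ x : Fin 3 → FiniteAdeleRing (𝓞 ↥(maximalRealSubfield L)) ↥(maximalRealSubfield L),
          ∏ᶠ v : HeightOneSpectrum (𝓞 ↥(maximalRealSubfield L)),
            ω v (fun i => x i v) * (((∏ w' : PlacesOver L v, max 1 (max ((normAbs (w'.1.adicCompletion L) (quadraticLocalEquiv L v (IsCMField.complexConj L) hcδ hδ (x 0 v, x 1 v) w') : ℝ≥0) : ℝ)
              ((normAbs (w'.1.adicCompletion L) ((toLocalRing L v (x 2 v) * algebraMap L (LocalRing L v) δ -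
                toLocalRing L v 2⁻¹ * (quadraticLocalEquiv L v (IsCMField.complexConj L) hcδ hδ (x 0 v, x 1 v) *
                  conjLocal L (IsCMField.complexConj L) v (quadraticLocalEquiv L v (IsCMField.complexConj L) hcδ hδ (x 0 v, x 1 v)))) w') : ℝ≥0) : ℝ))) : ℝ) : ℂ) ^ (-z) ∂μ =
      (∏ v ∈ S₀, ((Measure.pi fun _ : Fin 3 => νv v) (integralBox ↥(maximalRealSubfield L) (Fin 3) v)).toReal⁻¹ •
          ∫ p : Fin 3 → v.adicCompletion ↥(maximalRealSubfield L),
            ω v p * (((∏ w' : PlacesOver L v, max 1 (max ((normAbs (w'.1.adicCompletion L) (quadraticLocalEquiv L v (IsCMField.complexConj L) hcδ hδ (p 0, p 1) w') : ℝ≥0) : ℝ)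
              ((normAbs (w'.1.adicCompletion L) ((toLocalRing L v (p 2) * algebraMap L (LocalRing L v) δ -
                toLocalRing L v 2⁻¹ * (quadraticLocalEquiv L v (IsCMField.complexConj L) hcδ hδ (p 0, p 1) *
                  conjLocal L (IsCMField.complexConj L) v (quadraticLocalEquiv L v (IsCMField.complexConj L) hcδ hδ (p 0, p 1)))) w') : ℝ≥0) : ℝ))) : ℝ) : ℂ) ^ (-z)
            ∂(Measure.pi fun _ : Fin 3 => νv v)) *
        ((partialStandardL {w : HeightOneSpectrum (𝓞 L) | w.under (𝓞 ↥(maximalRealSubfield L)) ∈ (↑S₀ : Set (HeightOneSpectrum (𝓞 ↥(maximalRealSubfield L))))} (fun w => {φ.valueAtUniformizer w}) (z - 1) *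
            partialStandardL (↑S₀ : Set (HeightOneSpectrum (𝓞 ↥(maximalRealSubfield L)))) (fun v => {(ψ * quadraticHeckeCharCM L).valueAtUniformizer v}) (2 * z - 2)) /
          (partialStandardL {w : HeightOneSpectrum (𝓞 L) | w.under (𝓞 ↥(maximalRealSubfield L)) ∈ (↑S₀ : Set (HeightOneSpectrum (𝓞 ↥(maximalRealSubfield L))))} (fun w => {φ.valueAtUniformizer w}) z *
            partialStandardL (↑S₀ : Set (HeightOneSpectrum (𝓞 ↥(maximalRealSubfield L)))) (fun v => {(ψ * quadraticHeckeCharCM L).valueAtUniformizer v}) (2 * z - 1))) :=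
  eq_prod_mul_of_hasProd S₀ (hasProd_chiLocalMean_three L hcδ hδ hd μ νv S₀ ω z (fun v hv => (hgood v hv).1) hωc hω1 hint)
    (hasProd_chiLocalMean_eq_chiScalar_off L S₀ z hφ hψ hres hz (fun v hv => ⟨(hgood v hv).1.1, (hgood v hv).2⟩) _
      (fun v hv w hw => hin v hv w hw) (fun v hv w hw => hsp v hv w hw))
    (fun _ _ => rfl)

end Summit.HodgeConjecture.HodgeConjecture.Cruxes.H413.K2E1ChiIntertwiningScalarEulerProductU3Finite

end
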